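import Summits.KontsevichZagierPeriods.KontsevichZagierPeriods.Theorems.SoloInformedSeparableNL
import HarnessLib
import HarnessLib.Audit

/-!
# SoloInformed — rule (3) for integrands polynomial in the last variable (every dimension)

Solo programme `solo-KontsevichZagierPeriods-informed`, session s112, file 40.

The sum version of file 39.  Base representations `[D, h_j]` (`j < k`, common domain containing the
boundary domain `D`), `K`-polynomial bounds `a ≤ b` on `D` and `G_j ∈ K[X]`:
`[{(x, y) : x ∈ D, a(x) ≤ y ≤ b(x)}, Σ_j h_j(x) G_j'(y)] − [D, Σ_j h_j(x)(G_j(b x) − G_j(a x))] ∈ relations`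
— ONE move of rule (3) with primitive `F = Σ_j h_j(x) G_j(y)` (`soloInformed_polyBandNL_mem_relations`).
Since every `K`-polynomial in `y` with semialgebraic coefficient functions `h_j(x)` has this shape
(`G_j = X^{j+1}/(j+1)`), EVERY band integral whose integrand is polynomial in the last variable descends
by one dimension inside the KZ rules; span membership descends with it
(`soloInformed_segSpan_of_polyBandNL`) and the period conjecture follows against all weight-one classes
(`soloInformed_kzp_polyBandNL`).  Unconditional.

References: M. Kontsevich, D. Zagier, *Periods* (2001), §1.2 rule (3); this work.
-/

noncomputable section

open scoped BigOperators Polynomial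

namespace Summit.KontsevichZagierPeriods.KontsevichZagierPeriods.Theorems

open Set MeasureTheory
open Literature.ModelTheory.ExponentialFields
open Literature.NumberTheory.Transcendental Literature.NumberTheory.Transcendental.KZ

/-- **Rule (3) for `y`-polynomial integrands (any dimension).** [Kontsevich–Zagier 2001, §1.2 rule (3)] -/
theorem soloInformed_polyBandNL_mem_relations {n k : ℕ} (r : IntegralRep (n + 1))
    (R₀ : Fin k → IntegralRep n) (r₁ : IntegralRep n) (hD : ∀ j, r₁.domain ⊆ (R₀ j).domain)
    (a b : MvPolynomial (Fin n) (algebraicClosure ℚ ℝ)) (G : Fin k → (algebraicClosure ℚ ℝ)[X])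
    (hab : ∀ x ∈ r₁.domain, (MvPolynomial.aeval x a : ℝ) ≤ MvPolynomial.aeval x b)
    (hdom : r.domain = {z | (Fin.init z : Fin n → ℝ) ∈ r₁.domain ∧
      (MvPolynomial.aeval (Fin.init z : Fin n → ℝ) a : ℝ) ≤ z (Fin.last n) ∧
      z (Fin.last n) ≤ MvPolynomial.aeval (Fin.init z : Fin n → ℝ) b})
    (hf : ∀ z ∈ r.domain, r.integrand z = ∑ j, (R₀ j).integrand (Fin.init z) *
      Polynomial.aeval (z (Fin.last n)) (Polynomial.derivative (G j)))
    (hf₁ : ∀ x ∈ r₁.domain, r₁.integrand x = ∑ j, (R₀ j).integrand x *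
      ((Polynomial.aeval (MvPolynomial.aeval x b : ℝ) (G j) : ℝ) -
        Polynomial.aeval (MvPolynomial.aeval x a : ℝ) (G j))) :
    of r - of r₁ ∈ relations := by
  have hK := soloInformed_isAlgebraic_algebraMap_K
  have haX : ∀ (P : (algebraicClosure ℚ ℝ)[X]) (z : Fin (n + 1) → ℝ),
      (MvPolynomial.aeval z (Polynomial.aeval (MvPolynomial.X (Fin.last n) :
        MvPolynomial (Fin (n + 1)) (algebraicClosure ℚ ℝ)) P) : ℝ) = Polynomial.aeval (z (Fin.last n)) P :=
    fun P z => by rw [← Polynomial.aeval_algHom_apply, MvPolynomial.aeval_X]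
  set F : (Fin (n + 1) → ℝ) → ℝ := fun z => ∑ j, (R₀ j).integrand (Fin.init z) *
    Polynomial.aeval (z (Fin.last n)) (G j) with hFdef
  set fa : (Fin n → ℝ) → ℝ := fun x => MvPolynomial.aeval x a with hfadef
  set fb : (Fin n → ℝ) → ℝ := fun x => MvPolynomial.aeval x b with hfbdef
  have hFsnoc : ∀ (x : Fin n → ℝ) (t : ℝ), F (Fin.snoc x t) =
      ∑ j, (R₀ j).integrand x * Polynomial.aeval t (G j) := fun x t => by
    simp only [hFdef, Fin.init_snoc, Fin.snoc_last]
  have hmem : ∀ x ∈ r₁.domain, ∀ t, fa x ≤ t → t ≤ fb x → (Fin.snoc x t : Fin (n + 1) → ℝ) ∈ r.domain :=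
    fun x hx t h1 h2 => by
    rw [hdom]
    refine ⟨?_, ?_, ?_⟩
    · rw [Fin.init_snoc]; exact hx
    · rw [Fin.init_snoc, Fin.snoc_last]; exact h1
    · rw [Fin.init_snoc, Fin.snoc_last]; exact h2
  have hsub : ∀ j, r.domain ⊆ {z : Fin (n + 1) → ℝ | (Fin.init z : Fin n → ℝ) ∈ (R₀ j).domain} :=
    fun j z hz => by rw [hdom] at hz; exact hD j hz.1
  have hF : IsSemialgebraicFunOn ℚ r.domain F := by
    classical
    have hterm : ∀ j, IsSemialgebraicFunOn ℚ r.domain fun z =>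
        (R₀ j).integrand (Fin.init z) * Polynomial.aeval (z (Fin.last n)) (G j) := fun j => by
      have h1 : IsSemialgebraicFunOn ℚ r.domain fun z => (R₀ j).integrand (Fin.init z) :=
        (R₀ j).isSemialgebraicFunOn_integrand.comp_init.mono (hsub j) r.isSemialgebraic_domain
      have h2 : IsSemialgebraicFunOn ℚ r.domain fun z => (Polynomial.aeval (z (Fin.last n)) (G j) : ℝ) :=
        (soloInformed_isSemialgebraicFunOn_aevalK hK r.isSemialgebraic_domain
          (Polynomial.aeval (MvPolynomial.X (Fin.last n) : MvPolynomial (Fin (n + 1)) (algebraicClosure ℚ ℝ))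
            (G j))).congr fun z _ => by simp only [haX]
      exact (IsSemialgebraicFunOn.mul_holds h1 h2).congr fun z _ => by simp only [Pi.mul_apply]
    -- finite sums of semialgebraic functions are semialgebraic [BCR 1998, §2.2]
    have hsum : ∀ u : Finset (Fin k), IsSemialgebraicFunOn ℚ r.domain fun z =>
        ∑ j ∈ u, (R₀ j).integrand (Fin.init z) * Polynomial.aeval (z (Fin.last n)) (G j) := by
      intro u
      induction u using Finset.induction_on with
      | empty =>
        exact (isSemialgebraicFunOn_const_of_isAlgebraic r.isSemialgebraic_domain
          isAlgebraic_zero).congr fun z _ => by simp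
      | insert i u hi ih =>
        exact (IsSemialgebraicFunOn.add_holds (hterm i) ih).congr fun z _ => by
          simp only [Finset.sum_insert hi, Pi.add_apply]
    exact (hsum Finset.univ).congr fun z _ => by simp only [hFdef]
  have ha : IsSemialgebraicFunOn ℚ r₁.domain fa :=
    (soloInformed_isSemialgebraicFunOn_aevalK hK r₁.isSemialgebraic_domain a).congr fun x _ => by
      simp only [hfadef]
  have hb : IsSemialgebraicFunOn ℚ r₁.domain fb :=
    (soloInformed_isSemialgebraicFunOn_aevalK hK r₁.isSemialgebraic_domain b).congr fun x _ => by
      simp only [hfbdef]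
  refine newtonLeibnizRel_subset_relations ⟨n, r, r₁, fa, fb, F, hF, ha, hb, hab, ?_, ?_, ?_, ?_, rfl⟩
  · rw [hdom]
  · intro x hx
    have hc : Continuous fun t : ℝ => ∑ j, (R₀ j).integrand x * Polynomial.aeval t (G j) :=
      continuous_finsetSum _ fun j _ => continuous_const.mul (Polynomial.continuous_aeval (G j))
    exact hc.continuousOn.congr fun t _ => hFsnoc x t
  · intro x hx t ht
    have hfun : (fun s : ℝ => F (Fin.snoc x s)) = fun s => ∑ j, (R₀ j).integrand x * Polynomial.aeval s (G j) :=
      funext fun s => hFsnoc x s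
    rw [hfun, hf _ (hmem x hx t ht.1.le ht.2.le), Fin.init_snoc, Fin.snoc_last]
    exact HasDerivAt.fun_sum (u := Finset.univ)
      (A := fun j s => (R₀ j).integrand x * Polynomial.aeval s (G j))
      (A' := fun j => (R₀ j).integrand x * Polynomial.aeval t (Polynomial.derivative (G j)))
      fun j _ => (Polynomial.hasDerivAt_aeval (G j) t).const_mul _
  · intro x hx
    rw [hf₁ x hx, hFsnoc, hFsnoc, ← Finset.sum_sub_distrib]
    exact Finset.sum_congr rfl fun j _ => by ring

/-- **Span membership descends along `y`-polynomial bands (any dimension)**, with KZ-equivalence of the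
band and boundary representations. -/
theorem soloInformed_segSpan_of_polyBandNL {n k : ℕ} (r : IntegralRep (n + 1))
    (R₀ : Fin k → IntegralRep n) (r₁ : IntegralRep n) (hD : ∀ j, r₁.domain ⊆ (R₀ j).domain)
    (a b : MvPolynomial (Fin n) (algebraicClosure ℚ ℝ)) (G : Fin k → (algebraicClosure ℚ ℝ)[X])
    (hab : ∀ x ∈ r₁.domain, (MvPolynomial.aeval x a : ℝ) ≤ MvPolynomial.aeval x b)
    (hdom : r.domain = {z | (Fin.init z : Fin n → ℝ) ∈ r₁.domain ∧
      (MvPolynomial.aeval (Fin.init z : Fin n → ℝ) a : ℝ) ≤ z (Fin.last n) ∧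
      z (Fin.last n) ≤ MvPolynomial.aeval (Fin.init z : Fin n → ℝ) b})
    (hf : ∀ z ∈ r.domain, r.integrand z = ∑ j, (R₀ j).integrand (Fin.init z) *
      Polynomial.aeval (z (Fin.last n)) (Polynomial.derivative (G j)))
    (hf₁ : ∀ x ∈ r₁.domain, r₁.integrand x = ∑ j, (R₀ j).integrand x *
      ((Polynomial.aeval (MvPolynomial.aeval x b : ℝ) (G j) : ℝ) -
        Polynomial.aeval (MvPolynomial.aeval x a : ℝ) (G j)))
    (h₁ : of r₁ ∈ soloInformedSegSpan) :
    of r ∈ soloInformedSegSpan ∧ Equivalent r r₁ := by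
  have hrel := soloInformed_polyBandNL_mem_relations r R₀ r₁ hD a b G hab hdom hf hf₁
  have h : of r ∈ soloInformedSegSpan := soloInformed_mem_segSpan_of_sub_mem hrel h₁
  have hv : r.value = r₁.value := by
    have h0 : eval (of r - of r₁) = 0 := relations_le_ker_eval_holds hrel
    rw [map_sub, eval_of, eval_of] at h0
    exact sub_eq_zero.1 h0
  exact ⟨h, soloInformed_equivalent_of_mem_segSpan h h₁ hv⟩

/-- **The period conjecture along `y`-polynomial bands (any dimension)**: with the boundary
representation in the span, the band representation is KZ-equivalent to every elementary sum, every
Chebyshev–Euler integral, every rational representation of dimension `≤ 1` and every span member of the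
same value.  Unconditional. [Kontsevich–Zagier 2001, §1.2; this work] -/
theorem soloInformed_kzp_polyBandNL {n k : ℕ} (r : IntegralRep (n + 1))
    (R₀ : Fin k → IntegralRep n) (r₁ : IntegralRep n) (hD : ∀ j, r₁.domain ⊆ (R₀ j).domain)
    (a b : MvPolynomial (Fin n) (algebraicClosure ℚ ℝ)) (G : Fin k → (algebraicClosure ℚ ℝ)[X])
    (hab : ∀ x ∈ r₁.domain, (MvPolynomial.aeval x a : ℝ) ≤ MvPolynomial.aeval x b)
    (hdom : r.domain = {z | (Fin.init z : Fin n → ℝ) ∈ r₁.domain ∧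
      (MvPolynomial.aeval (Fin.init z : Fin n → ℝ) a : ℝ) ≤ z (Fin.last n) ∧
      z (Fin.last n) ≤ MvPolynomial.aeval (Fin.init z : Fin n → ℝ) b})
    (hf : ∀ z ∈ r.domain, r.integrand z = ∑ j, (R₀ j).integrand (Fin.init z) *
      Polynomial.aeval (z (Fin.last n)) (Polynomial.derivative (G j)))
    (hf₁ : ∀ x ∈ r₁.domain, r₁.integrand x = ∑ j, (R₀ j).integrand x *
      ((Polynomial.aeval (MvPolynomial.aeval x b : ℝ) (G j) : ℝ) -
        Polynomial.aeval (MvPolynomial.aeval x a : ℝ) (G j)))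
    (h₁ : of r₁ ∈ soloInformedSegSpan) :
    (∀ r₂ : IntegralRep 1, SoloInformedIsKElementarySumOne r₂ → r.value = r₂.value → Equivalent r r₂) ∧
    (∀ {m : ℕ} (hm : m ≠ 0) (r₂ : IntegralRep 1), SoloInformedIsKMobiusRadicalOne m r₂ →
      r.value = r₂.value → Equivalent r r₂) ∧
    (∀ {d : ℕ} (hd : d ≤ 1) (r' : IntegralRep d), r'.IsRational → r.value = r'.value →
      Equivalent r r') ∧
    (∀ {q : ℕ} (r₂ : IntegralRep q), of r₂ ∈ soloInformedSegSpan → r.value = r₂.value →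
      Equivalent r r₂) := by
  have h := (soloInformed_segSpan_of_polyBandNL r R₀ r₁ hD a b G hab hdom hf hf₁ h₁).1
  exact ⟨fun r₂ hr₂ hv => soloInformed_equivalent_of_mem_segSpan h
      (soloInformed_segSpan_of_isKElementarySumOne r₂ hr₂) hv,
    fun hm r₂ hr₂ hv => soloInformed_equivalent_of_mem_segSpan h
      (soloInformed_segSpan_of_isKMobiusRadicalOne hm r₂ hr₂) hv,
    fun hd r' hr' hv => soloInformed_equivalent_of_mem_segSpan h
      (soloInformed_of_mem_segSpan_of_isRational hd r' hr') hv,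
    fun r₂ hr₂ hv => soloInformed_equivalent_of_mem_segSpan h hr₂ hv⟩

end Summit.KontsevichZagierPeriods.KontsevichZagierPeriods.Theorems
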